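import Summits.CriticalPhenomena.PercolationContinuityZ3.Theorems.FK.InfiniteVolumeDLREquation
import HarnessLib

/-!
# FK-continuity transplant, FO-06 (construction half): the DLR equation (4.30) on the whole outside σ-algebra,
# as a conditional expectation, and Thm. (4.34)(b): the box limits `φ^b_{p,q}` are DLR random-cluster measures

Cell `fk-continuity` (bschramm), row FO-06b-6; support file for the FK-continuity transplant
(`--supports stmt-CriticalPhenomena-4575`); builds on p205010 (kernel theorem, internal audit signed;
external expert review pending). No named facts, no sorries, standard axioms. General dimension `d`, both
boundary conditions `b`, `0 ≤ p ≤ 1`, `q ≥ 1`. Banked infinite-volume structure (GRC Thm. (4.34)(b)) for the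
Literature vocabulary and fk-ref FO-17; not an END-STATE dependency of the cell (not consumed by `_r3`); it says
nothing about FH / TP_FK or continuity at `p_c`.

* `IsBoxLimit.real_cylEvent_inter_eq_setIntegral` — `P({ω ∩ E_Λ = η} ∩ H) = ∫_H φ^ω_{Λ,p,q}(η) P(dω)` for EVERY
  `H ∈ 𝒯_Λ = outsideEvents d Λ` (from the local case of `InfiniteVolumeDLREquation.lean` by 06a-g2's ring
  approximation `exists_determinedBy_measure_symmDiff_lt`);
* `IsBoxLimit.condExp_indicator_cylEvent` — **Grimmett's (4.30)**: `P[1_{ω ∩ E_Λ = η} | 𝒯_Λ] = φ^·_{Λ,p,q}(η)`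
  `P`-a.s.;
* `IsBoxLimit.lintegral_rcCondLaw_eq`, **`IsBoxLimit.isDLRRandomCluster`**, `isDLRRandomCluster_rcLimit` —
  **Thm. (4.34)(b)**: every box limit, in particular `φ⁰_{p,q}` and `φ¹_{p,q}`, belongs to `R_{p,q}`
  (`IsDLRRandomCluster`, Def. (4.29)).

## References

* G. Grimmett, *The Random-Cluster Model*, Springer 2006: Def. (4.29) eq. (4.30), Thm. (4.34)(b), proof of
  Thm. (4.31) eq. (4.46) ("since 𝒯_Λ is generated by its cylinder events"), pp. 81–86. [Grimmett2006]
-/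

noncomputable section

open MeasureTheory Set Filter
open scoped Topology ENNReal symmDiff

namespace Summit.CriticalPhenomena.PercolationContinuityZ3.Theorems.FK

open Literature.Probability.Percolation Literature.Probability.LatticeModels

variable {d : ℕ}

/-! ### From local outside events to the outside σ-algebra -/

section Outside

variable {b : Bool} {p q : ℝ} {P : Measure (BondConfig (Site d))}

/-- Set integrals of a `[0,1]`-valued function over two sets differ by at most the measure of the symmetric
difference. [folklore] -/
theorem abs_setIntegral_sub_setIntegral_le_measureReal_symmDiff {α : Type*} {mα : MeasurableSpace α}
    (μ : Measure α) [IsFiniteMeasure μ] {f : α → ℝ} (hf : Integrable f μ) (h0 : ∀ x, 0 ≤ f x) (h1 : ∀ x, f x ≤ 1)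
    {s t : Set α} (hs : MeasurableSet s) (ht : MeasurableSet t) :
    |∫ x in s, f x ∂μ - ∫ x in t, f x ∂μ| ≤ μ.real (s ∆ t) := by
  rw [← integral_inter_add_sdiff ht hf.integrableOn, ← integral_inter_add_sdiff hs (hf.integrableOn (s := t)),
    Set.inter_comm t s, measureReal_symmDiff_eq hs ht]
  have hb : ∀ u : Set α, ∫ x in u, f x ∂μ ∈ Set.Icc 0 (μ.real u) := by
    intro u
    constructor
    · exact setIntegral_nonneg_of_ae (ae_of_all _ h0)
    · have h := norm_setIntegral_le_of_norm_le_const (μ := μ) (s := u) (measure_lt_top μ u) (f := f) (C := 1)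
        fun x _ => by rw [Real.norm_eq_abs, abs_le]; exact ⟨by linarith [h0 x], h1 x⟩
      rw [one_mul, Real.norm_eq_abs] at h
      exact (le_abs_self _).trans h
  rw [abs_le]
  have h₁ := hb (s \ t)
  have h₂ := hb (t \ s)
  constructor <;> linarith [h₁.1, h₁.2, h₂.1, h₂.2]

/-- **The DLR equation against every outside event** (Grimmett 2006, (4.30) integrated; "𝒯_Λ is generated by its
cylinder events", proof of Thm. (4.31) eq. (4.46)): for a box limit `P` (`0 ≤ p ≤ 1`, `q ≥ 1`), a finite region
`Λ`, an inside pattern `η ⊆ E_Λ` and `H ∈ 𝒯_Λ`,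
`P({ω ∩ E_Λ = η} ∩ H) = ∫_H φ^ω_{Λ,p,q}(η) P(dω)`. [cite: Grimmett2006, Thm. (4.34)(b), Def. (4.29) eq. (4.30)] -/
theorem IsBoxLimit.real_cylEvent_inter_eq_setIntegral (hP : IsBoxLimit d b p q P) (hp : p ∈ Set.Icc (0 : ℝ) 1)
    (hq : 1 ≤ q) {Λ : Finset (Site d)} {η : Finset (Sym2 (Site d))} (hη : η ⊆ edgesIn (zdGraph d) Λ)
    {H : Set (BondConfig (Site d))} (hH : MeasurableSet[outsideEvents d Λ] H) :
    P.real (cylEvent (edgesIn (zdGraph d) Λ) η ∩ H) = ∫ ω in H, rcCondProb p q Λ ω η ∂P := by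
  classical
  haveI := hP.isProbabilityMeasure
  have hq0 : 0 < q := one_pos.trans_le hq
  have hHm : MeasurableSet H := outsideEvents_le Λ _ hH
  have hCm : MeasurableSet (cylEvent (edgesIn (zdGraph d) Λ) η) := measurableSet_cylEvent _ η
  have hint : Integrable (fun ω => rcCondProb p q Λ ω η) P := integrable_rcCondProb P hp hq0 Λ hη
  refine eq_of_forall_dist_le fun ε hε => ?_
  -- approximate `H` by a local outside event `H'`
  obtain ⟨T, hT, H', hH', hμ⟩ := exists_determinedBy_measure_symmDiff_lt P hH
    (ENNReal.ofReal_pos.2 (half_pos hε))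
  have hH'm : MeasurableSet H' := hH'.measurableSet_of_finset
  have hTU : Disjoint (↑T : Set (Sym2 (Site d))) ↑(edgesIn (zdGraph d) Λ) :=
    Set.disjoint_left.2 fun e heT heU => hT heT heU
  have hsymm : P.real (H' ∆ H) < ε / 2 := (ENNReal.lt_ofReal_iff_toReal_lt (measure_ne_top P _)).1 hμ
  have hloc := hP.real_cylEvent_inter_eq_setIntegral_of_determinedBy hp hq hη hH' hTU
  -- both sides move by at most `P(H' ∆ H)`
  have h1 : |P.real (cylEvent (edgesIn (zdGraph d) Λ) η ∩ H) - P.real (cylEvent (edgesIn (zdGraph d) Λ) η ∩ H')| ≤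
      P.real (H ∆ H') := by
    have key := abs_setIntegral_sub_setIntegral_le_measureReal_symmDiff P
      ((integrable_const (1 : ℝ)).indicator hCm) (fun ω => Set.indicator_nonneg (fun _ _ => zero_le_one) ω)
      (fun ω => Set.indicator_le_self' (fun _ _ => zero_le_one) ω) hHm hH'm
    rwa [setIntegral_indicator hCm, setIntegral_indicator hCm, setIntegral_const, setIntegral_const, smul_eq_mul,
      smul_eq_mul, mul_one, mul_one, Set.inter_comm H, Set.inter_comm H'] at key
  have h2 : |∫ ω in H, rcCondProb p q Λ ω η ∂P - ∫ ω in H', rcCondProb p q Λ ω η ∂P| ≤ P.real (H ∆ H') :=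
    abs_setIntegral_sub_setIntegral_le_measureReal_symmDiff P hint (fun ω => rcCondProb_nonneg hp hq0 Λ ω η)
      (fun ω => rcCondProb_le_one hp hq0 Λ ω hη) hHm hH'm
  rw [symmDiff_comm] at hsymm
  rw [Real.dist_eq, abs_le]
  rw [abs_le] at h1 h2
  constructor <;> linarith [h1.1, h1.2, h2.1, h2.2]

/-- The same for THE limit `rcLimit d b p q`. [cite: Grimmett2006, Thm. (4.34)(b)] -/
theorem rcLimit_real_cylEvent_inter_eq_setIntegral (b : Bool) (hp : p ∈ Set.Icc (0 : ℝ) 1) (hq : 1 ≤ q)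
    {Λ : Finset (Site d)} {η : Finset (Sym2 (Site d))} (hη : η ⊆ edgesIn (zdGraph d) Λ)
    {H : Set (BondConfig (Site d))} (hH : MeasurableSet[outsideEvents d Λ] H) :
    (rcLimit d b p q).real (cylEvent (edgesIn (zdGraph d) Λ) η ∩ H) =
      ∫ ω in H, rcCondProb p q Λ ω η ∂(rcLimit d b p q) :=
  (isBoxLimit_rcLimit b hp hq).real_cylEvent_inter_eq_setIntegral hp hq hη hH

/-! ### (4.30) as a conditional expectation -/

/-- **Grimmett's DLR equation (4.30) for the box limits**: for every box limit `P` (`0 ≤ p ≤ 1`, `q ≥ 1`, either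
boundary condition), every finite region `Λ` and every inside pattern `η ⊆ E_Λ`,
`P[1_{ω ∩ E_Λ = η} | 𝒯_Λ](ξ) = φ^ξ_{Λ,p,q}(η)` for `P`-a.e. `ξ`: conditionally on the configuration off `E_Λ`, the
configuration on `E_Λ` is distributed by the random-cluster measure of `Λ` with the induced boundary condition.
[cite: Grimmett2006, Def. (4.29) eq. (4.30), Thm. (4.34)(b)] -/
theorem IsBoxLimit.condExp_indicator_cylEvent (hP : IsBoxLimit d b p q P) (hp : p ∈ Set.Icc (0 : ℝ) 1)
    (hq : 1 ≤ q) {Λ : Finset (Site d)} {η : Finset (Sym2 (Site d))} (hη : η ⊆ edgesIn (zdGraph d) Λ) :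
    (fun ξ : BondConfig (Site d) => rcCondProb p q Λ ξ η) =ᵐ[P]
      P[(cylEvent (edgesIn (zdGraph d) Λ) η).indicator (fun _ => (1 : ℝ)) | outsideEvents d Λ] := by
  haveI := hP.isProbabilityMeasure
  have hq0 : 0 < q := one_pos.trans_le hq
  have hCm : MeasurableSet (cylEvent (edgesIn (zdGraph d) Λ) η) := measurableSet_cylEvent _ η
  have hint : Integrable (fun ω => rcCondProb p q Λ ω η) P := integrable_rcCondProb P hp hq0 Λ hη
  refine ae_eq_condExp_of_forall_setIntegral_eq (outsideEvents_le Λ) ((integrable_const (1 : ℝ)).indicator hCm)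
    (fun s _ _ => hint.integrableOn) (fun s hs _ => ?_)
    (measurable_rcCondProb_outsideEvents p q Λ η).stronglyMeasurable.aestronglyMeasurable
  rw [setIntegral_indicator hCm, setIntegral_const, smul_eq_mul, mul_one, Set.inter_comm,
    hP.real_cylEvent_inter_eq_setIntegral hp hq hη hs]

end Outside

/-! ### Thm. (4.34)(b): the box limits are DLR random-cluster measures -/

section DLR

variable {b : Bool} {p q : ℝ} {P : Measure (BondConfig (Site d))}

/-- A measurable event is the disjoint union of its traces on the cylinders over `F`. [cite: Grimmett2006, §4.1] -/
theorem measure_eq_sum_measure_cylEvent_inter {ι : Type*} (μ : Measure (Set ι)) (F : Finset ι) {A : Set (Set ι)}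
    (hA : MeasurableSet A) : μ A = ∑ S ∈ F.powerset, μ (cylEvent F S ∩ A) := by
  classical
  have hcov : A = ⋃ S ∈ F.powerset, (cylEvent F S ∩ A) := by
    ext ω
    simp only [Set.mem_iUnion, Set.mem_inter_iff, exists_prop]
    constructor
    · intro hω
      refine ⟨F.filter (· ∈ ω), Finset.mem_powerset.2 (Finset.filter_subset _ _), ?_, hω⟩
      exact (mem_cylEvent_iff_eq_filter (Finset.filter_subset _ F) ω).2 rfl
    · rintro ⟨S, -, -, hω⟩; exact hω
  conv_lhs => rw [hcov]
  refine measure_biUnion_finset ?_ fun S _ => (measurableSet_cylEvent F S).inter hA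
  intro S hS S' hS' hne
  exact (disjoint_cylEvent_of_ne (Finset.mem_powerset.1 hS) (Finset.mem_powerset.1 hS') hne).mono
    Set.inter_subset_left Set.inter_subset_left

/-- On the cylinder `{ω ∩ E_Λ = η}`, the configuration IS `η ∪ (ω ∖ E_Λ)`. [cite: Grimmett2006, §4.2 (4.11)] -/
theorem coe_union_sdiff_eq_self_of_mem_cylEvent {Λ : Finset (Site d)} {η : Finset (Sym2 (Site d))}
    (hη : η ⊆ edgesIn (zdGraph d) Λ) {ω : BondConfig (Site d)} (hω : ω ∈ cylEvent (edgesIn (zdGraph d) Λ) η) :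
    (↑η : Set (Sym2 (Site d))) ∪ (ω \ ↑(edgesIn (zdGraph d) Λ)) = ω := by
  ext e
  simp only [Set.mem_union, Finset.mem_coe, Set.mem_sdiff]
  constructor
  · rintro (he | ⟨he, -⟩)
    · exact (mem_cylEvent_iff.1 hω e (hη he)).2 he
    · exact he
  · intro he
    by_cases heU : e ∈ edgesIn (zdGraph d) Λ
    · exact Or.inl ((mem_cylEvent_iff.1 hω e heU).1 he)
    · exact Or.inr ⟨he, heU⟩

/-- The pull-back of an event under "overwrite `E_Λ` by `η`" is an outside event. [folklore] -/
theorem measurableSet_outsideEvents_preimage_union_sdiff (Λ : Finset (Site d)) (η : Finset (Sym2 (Site d)))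
    {A : Set (BondConfig (Site d))} (hA : MeasurableSet A) :
    MeasurableSet[outsideEvents d Λ]
      ((fun ξ : BondConfig (Site d) => (↑η : Set (Sym2 (Site d))) ∪ (ξ \ ↑(edgesIn (zdGraph d) Λ))) ⁻¹' A) := by
  have hf : Measurable fun ξ : BondConfig (Site d) =>
      (↑η : Set (Sym2 (Site d))) ∪ (ξ \ ↑(edgesIn (zdGraph d) Λ)) :=
    measurable_set_iff.2 fun e => measurable_const.or ((measurable_set_mem e).and measurable_const)
  refine measurableSet_cylinderEvents_of_determinedBy (hA.preimage hf) ?_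
  rw [determinedBy_iff]
  intro ω ω' hωω'
  change (↑η ∪ (ω \ ↑(edgesIn (zdGraph d) Λ)) ∈ A) ↔ (↑η ∪ (ω' \ ↑(edgesIn (zdGraph d) Λ)) ∈ A)
  rw [Set.sdiff_eq, Set.sdiff_eq, hωω']

/-- **The integrated DLR equation**: `∫ φ^ξ_{Λ,p,q}(A) P(dξ) = P(A)` for every box limit `P` (`0 ≤ p ≤ 1`, `q ≥ 1`),
every finite region `Λ` and every event `A`. [cite: Grimmett2006, Thm. (4.34)(b), Def. (4.29)] -/
theorem IsBoxLimit.lintegral_rcCondLaw_eq (hP : IsBoxLimit d b p q P) (hp : p ∈ Set.Icc (0 : ℝ) 1) (hq : 1 ≤ q)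
    (Λ : Finset (Site d)) {A : Set (BondConfig (Site d))} (hA : MeasurableSet A) :
    ∫⁻ ξ, rcCondLaw p q Λ ξ A ∂P = P A := by
  classical
  haveI := hP.isProbabilityMeasure
  have hq0 : 0 < q := one_pos.trans_le hq
  set U := edgesIn (zdGraph d) Λ with hU
  set Hη : Finset (Sym2 (Site d)) → Set (BondConfig (Site d)) := fun η =>
    (fun ξ : BondConfig (Site d) => (↑η : Set (Sym2 (Site d))) ∪ (ξ \ ↑U)) ⁻¹' A with hHη
  have hHηo : ∀ η, MeasurableSet[outsideEvents d Λ] (Hη η) := fun η =>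
    measurableSet_outsideEvents_preimage_union_sdiff Λ η hA
  have hHηm : ∀ η, MeasurableSet (Hη η) := fun η => outsideEvents_le Λ _ (hHηo η)
  -- the law at `ξ`, evaluated on `A`, as a finite sum of kernel values times indicators
  have happly : ∀ ξ, rcCondLaw p q Λ ξ A =
      ∑ η ∈ U.powerset, (Hη η).indicator (fun ξ => ENNReal.ofReal (rcCondProb p q Λ ξ η)) ξ := by
    intro ξ
    rw [rcCondLaw_eq, Measure.finsetSum_apply]
    refine Finset.sum_congr rfl fun η _ => ?_
    rw [Measure.smul_apply, Measure.dirac_apply' _ hA, smul_eq_mul]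
    by_cases h : ((↑η : Set (Sym2 (Site d))) ∪ (ξ \ ↑U)) ∈ A
    · rw [Set.indicator_of_mem h, Set.indicator_of_mem (show ξ ∈ Hη η from h), Pi.one_apply, mul_one]
    · rw [Set.indicator_of_notMem h, Set.indicator_of_notMem (show ξ ∉ Hη η from h), mul_zero]
  simp_rw [happly]
  rw [lintegral_finsetSum _ fun η _ =>
    ((measurable_rcCondProb p q Λ η).ennreal_ofReal).indicator (hHηm η)]
  -- each term is `P(C_η ∩ H_η) = P(C_η ∩ A)`
  have hterm : ∀ η ∈ U.powerset,
      ∫⁻ ξ, (Hη η).indicator (fun ξ => ENNReal.ofReal (rcCondProb p q Λ ξ η)) ξ ∂P = P (cylEvent U η ∩ A) := by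
    intro η hη
    have hη' := Finset.mem_powerset.1 hη
    rw [lintegral_indicator (hHηm η),
      ← ofReal_integral_eq_lintegral_ofReal (integrable_rcCondProb P hp hq0 Λ hη').integrableOn
        (ae_of_all _ fun ξ => rcCondProb_nonneg hp hq0 Λ ξ η),
      ← hP.real_cylEvent_inter_eq_setIntegral hp hq hη' (hHηo η), ofReal_measureReal]
    congr 1
    ext ω
    simp only [Set.mem_inter_iff, hHη, Set.mem_preimage]
    constructor
    · rintro ⟨hC, hAω⟩
      rw [coe_union_sdiff_eq_self_of_mem_cylEvent hη' hC] at hAω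
      exact ⟨hC, hAω⟩
    · rintro ⟨hC, hAω⟩
      rw [← coe_union_sdiff_eq_self_of_mem_cylEvent hη' hC] at hAω
      exact ⟨hC, hAω⟩
  rw [Finset.sum_congr rfl hterm, ← measure_eq_sum_measure_cylEvent_inter P U hA]

variable (d) in
/-- **Grimmett 2006, Thm. (4.34)(b): every box limit is a DLR random-cluster measure** — for `0 ≤ p ≤ 1`, `q ≥ 1`
and either boundary condition `b`, `IsBoxLimit d b p q P → P ∈ R_{p,q}` (Def. (4.29); hypothesis-free: the a.s.
uniqueness of the infinite cluster it rests on is the cell's Burton–Keane theorem for box limits).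
[cite: Grimmett2006, Thm. (4.34)(b)] -/
theorem IsBoxLimit.isDLRRandomCluster (hP : IsBoxLimit d b p q P) (hp : p ∈ Set.Icc (0 : ℝ) 1) (hq : 1 ≤ q) :
    IsDLRRandomCluster d p q P where
  isProbabilityMeasure := hP.isProbabilityMeasure
  lintegral_rcCondLaw_eq Λ _ hA := hP.lintegral_rcCondLaw_eq hp hq Λ hA

/-- **`φ^b_{p,q} ∈ R_{p,q}`**: the free (`b = false`) and wired (`b = true`) infinite-volume random-cluster
measures `rcLimit d b p q` on `ℤ^d` are DLR random-cluster measures, `0 ≤ p ≤ 1`, `q ≥ 1`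
(Grimmett 2006, Thm. (4.34)(b)). [cite: Grimmett2006, Thm. (4.34)(b)] -/
theorem isDLRRandomCluster_rcLimit (b : Bool) (hp : p ∈ Set.Icc (0 : ℝ) 1) (hq : 1 ≤ q) :
    IsDLRRandomCluster d p q (rcLimit d b p q) :=
  (isBoxLimit_rcLimit b hp hq).isDLRRandomCluster d hp hq

end DLR

end Summit.CriticalPhenomena.PercolationContinuityZ3.Theorems.FK

end
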